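import Literature.NumberTheory.Automorphic.WhittakerTowerEquivariance
import HarnessLib

/-!
# The Whittaker tower, IV: the bottom `Φ_0` is the box average over `N_n` against `ψ_N`

Topic `NumberTheory/Automorphic`; namespace `Literature.NumberTheory.Automorphic`. The partial
Whittaker transforms `whittakerIter k φ` were defined column by column (`WhittakerTower`). Here we
prove the closed formula

  `whittakerIter k φ (g) = ν(box)⁻¹ ∫_{box} φ(u g) conj ψ_{≥ n-k}(u) dν(u)`

for every Haar measure `ν` of `U_{[n-k, n-1]}(𝔸_K)` and its Tate box (`whittakerIter_eq_boxIntegral`,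
`φ` continuous, `1 ≤ n - k`), by induction on `k`: the box of `U_{[c,n-1]} = U_{[c+1,n-1]} · Y_c` is the
product of the boxes and a Haar measure of the product is the product of Haar measures up to a
scalar (`UnipotentColumnSplit`), so the normalised box averages compose
(`setIntegral_box_eq_mul_setIntegral_prod`), while `ψ_{≥c}(u y) = ψ_{≥c+1}(u) ψ(y_{c-1,c})`
(`superdiagSumFrom_high_mul_low`). For `k = n - 1` this is the global `ψ`-Whittaker integral of `φ`
over the Tate box of `N_n(𝔸_K) = U_{[1,n-1]}(𝔸_K)` (Cogdell (2004), §1.1: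
`W_φ(g) = ∫_{N(k)\N(𝔸)} φ(ng) ψ⁻¹(n) dn`); the comparison with `whittakerCoeff` of
`GlobalWhittakerCoefficient` is left to the sequel. Everything is proved.

## References

* J. W. Cogdell, *Analytic theory of L-functions for GL_n*, in *An Introduction to the Langlands
  Program* (2004), §1.1 [CogdellAnalyticTheory2004].
-/

noncomputable section

open MeasureTheory Measure NumberField IsDedekindDomain Matrix Set Filter Topology
open scoped MatrixGroups ENNReal NNReal ComplexConjugate

namespace Literature.NumberTheory.Automorphic

section Bottom

variable {n : ℕ} {K : Type} [Field K] [NumberField K]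
variable [MeasurableSpace (GL (Fin n) (AdeleRing (𝓞 K) K))] [BorelSpace (GL (Fin n) (AdeleRing (𝓞 K) K))]

/-- **Box integrals in split coordinates (Bochner form).** For Haar measures `ν` on `U_{[a,b]}(𝔸_K)`,
`μ_H` on `U_{[m+1,b]}(𝔸_K)`, `μ_L` on `U_{[a,m]}(𝔸_K)` (`a ≤ m + 1`, `m ≤ b`) there is `c ∈ (0,∞)` with
`ν(box) = c μ_H(box_H) μ_L(box_L)` and, for every continuous `F`,
`∫_{box} F dν = c ∫_{box_H} ∫_{box_L} F(h ℓ) dμ_L dμ_H` (`ν = c · (h,ℓ)_*(μ_H ⊗ μ_L)` by uniqueness of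
Haar measure, `isHaarMeasure_map_colSplitHomeomorph`; the box is the image of the product of the
boxes; Fubini for the continuous, hence bounded, integrand on the relatively compact boxes).
[folklore] -/
theorem setIntegral_box_eq_mul_setIntegral_prod {a b : ℕ} (m : ℕ) (hab : a ≤ m + 1) (hmb : m ≤ b)
    (μH : Measure ↥(adelicColRange n K (m + 1) b)) (μL : Measure ↥(adelicColRange n K a m))
    [IsHaarMeasure μH] [IsHaarMeasure μL] (ν : Measure ↥(adelicColRange n K a b)) [IsHaarMeasure ν] :
    ∃ c : ℝ≥0∞, c ≠ 0 ∧ c ≠ ⊤ ∧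
      ν (colRangeTateDomain n K a b) = c * (μH (colRangeTateDomain n K (m + 1) b) * μL (colRangeTateDomain n K a m)) ∧
      ∀ {E : Type*} [NormedAddCommGroup E] [NormedSpace ℝ E] [CompleteSpace E]
        (F : ↥(adelicColRange n K a b) → E), Continuous F →
        (∫ u in colRangeTateDomain n K a b, F u ∂ν =
          c.toReal • ∫ h in colRangeTateDomain n K (m + 1) b, ∫ ℓ in colRangeTateDomain n K a m,
            F (colSplitHomeomorph (n := n) (K := K) m hab hmb (h, ℓ)) ∂μL ∂μH) ∧
        (∫ u in colRangeTateDomain n K a b, F u ∂ν =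
          c.toReal • ∫ ℓ in colRangeTateDomain n K a m, ∫ h in colRangeTateDomain n K (m + 1) b,
            F (colSplitHomeomorph (n := n) (K := K) m hab hmb (h, ℓ)) ∂μH ∂μL) := by
  haveI := isHaarMeasure_map_colSplitHomeomorph (n := n) (K := K) m hab hmb μH μL
  set Eq := colSplitHomeomorph (n := n) (K := K) m hab hmb with hEq
  have hEm : MeasurableEmbedding Eq := Eq.toMeasurableEquiv.measurableEmbedding
  set c : ℝ≥0 := haarScalarFactor ν ((μH.prod μL).map Eq) with hc
  have hν : ν = (c : ℝ≥0∞) • (μH.prod μL).map Eq := by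
    have h := isMulLeftInvariant_eq_smul ν ((μH.prod μL).map Eq)
    conv_lhs => rw [h]
    rfl
  have hc0 : (c : ℝ≥0∞) ≠ 0 := by exact_mod_cast (haarScalarFactor_pos_of_isHaarMeasure ν ((μH.prod μL).map Eq)).ne'
  have hboxes : Eq ⁻¹' colRangeTateDomain n K a b =
      colRangeTateDomain n K (m + 1) b ×ˢ colRangeTateDomain n K a m := by
    rw [← image_colSplitHomeomorph_prod m hab hmb, ← hEq]
    exact Eq.injective.preimage_image _
  have hmH : MeasurableSet (colRangeTateDomain n K (m + 1) b) := measurableSet_colRangeTateDomain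
  have hmL : MeasurableSet (colRangeTateDomain n K a m) := measurableSet_colRangeTateDomain
  have hmB : MeasurableSet (colRangeTateDomain n K a b) := measurableSet_colRangeTateDomain
  refine ⟨c, hc0, ENNReal.coe_ne_top, ?_, ?_⟩
  · rw [hν, Measure.smul_apply, Measure.map_apply Eq.continuous.measurable hmB, hboxes, Measure.prod_prod,
      smul_eq_mul]
  · intro E _ _ _ F hF
    have hcont : Continuous fun p : ↥(adelicColRange n K (m + 1) b) × ↥(adelicColRange n K a m) => F (Eq p) :=
      hF.comp Eq.continuous
    have hint : IntegrableOn (fun p => F (Eq p))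
        (colRangeTateDomain n K (m + 1) b ×ˢ colRangeTateDomain n K a m) (μH.prod μL) :=
      (hcont.continuousOn.integrableOn_compact
        (isCompact_closure_colRangeTateDomain.prod isCompact_closure_colRangeTateDomain)).mono_set
        (Set.prod_mono subset_closure subset_closure)
    rw [hν, Measure.restrict_smul, integral_smul_measure, hEm.setIntegral_map, hboxes]
    constructor
    · rw [setIntegral_prod _ hint]
    · congr 1
      have hint' : Integrable (fun p => F (Eq p))
          ((μH.restrict (colRangeTateDomain n K (m + 1) b)).prod (μL.restrict (colRangeTateDomain n K a m))) := by
        rw [Measure.prod_restrict]; exact hint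
      rw [← Measure.prod_restrict, integral_prod_symm _ hint']

omit [MeasurableSpace (GL (Fin n) (AdeleRing (𝓞 K) K))] [BorelSpace (GL (Fin n) (AdeleRing (𝓞 K) K))] in
/-- The Tate box of the trivial column range `U_{[n, n-1]} = 1` is everything. [folklore] -/
theorem colRangeTateDomain_eq_univ_of_lt {a b : ℕ} (h : b < a) :
    colRangeTateDomain n K a b = Set.univ := by
  ext u
  simp only [Set.mem_univ, iff_true]
  intro i j hij
  by_cases hj : InColRange n a b j
  · exact absurd hj fun hj => by have := hj.1; have := hj.2; omega
  · rw [apply_of_not_inColRange u.2 i hj, if_neg (ne_of_lt hij)]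
    exact zero_mem_adeleFundamentalDomain K

/-- **The closed formula for the partial Whittaker transforms.** For `φ` continuous, `k + 1 ≤ n`, every
Haar measure `ν` of `U_{[n-k, n-1]}(𝔸_K)` and every `g`,
`whittakerIter k φ g = ν(box)⁻¹ ∫_{box} φ(u g) conj ψ_{≥ n-k}(u) dν(u)`. [folklore] -/
theorem whittakerIter_eq_boxIntegral {φ : GL (Fin n) (AdeleRing (𝓞 K) K) → ℂ} (hφ : Continuous φ) :
    ∀ (k : ℕ), k + 1 ≤ n → ∀ (ν : Measure ↥(adelicColRange n K (n - k) (n - 1))) [IsHaarMeasure ν]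
      (g : GL (Fin n) (AdeleRing (𝓞 K) K)),
      whittakerIter k φ g = ((ν (colRangeTateDomain n K (n - k) (n - 1))).toReal)⁻¹ •
        ∫ u in colRangeTateDomain n K (n - k) (n - 1),
          φ ((u : GL (Fin n) (AdeleRing (𝓞 K) K)) * g) * conj (unipotentCharFrom (K := K) (n - k) (u : GL (Fin n) (AdeleRing (𝓞 K) K)) : ℂ) ∂ν
  | 0, hn, ν, hν, g => by
    haveI := hν
    -- the group is trivial and the box is everything
    have hbot : adelicColRange n K (n - 0) (n - 1) = ⊥ :=
      unipotentColRange_eq_bot fun j h => by have := j.2; have h1 := h.1; simp at h1; omega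
    have h1 : ∀ u : ↥(adelicColRange n K (n - 0) (n - 1)), u = 1 := fun u =>
      Subtype.ext (Subgroup.mem_bot.1 ((SetLike.ext_iff.mp hbot (u : GL (Fin n) (AdeleRing (𝓞 K) K))).1 u.2))
    have huniv : colRangeTateDomain n K (n - 0) (n - 1) = Set.univ :=
      colRangeTateDomain_eq_univ_of_lt (by simp; omega)
    have huniv1 : (Set.univ : Set ↥(adelicColRange n K (n - 0) (n - 1))) = {1} := by
      ext u; simp [h1 u]
    simp only [whittakerIter]
    rw [huniv, Measure.restrict_univ]
    have hconst : (fun u : ↥(adelicColRange n K (n - 0) (n - 1)) =>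
        φ ((u : GL (Fin n) (AdeleRing (𝓞 K) K)) * g) * conj (unipotentCharFrom (K := K) (n - 0) (u : GL (Fin n) (AdeleRing (𝓞 K) K)) : ℂ)) =
        fun _ => φ g := by
      funext u
      rw [h1 u, Subgroup.coe_one, one_mul, unipotentCharFrom_one, Circle.coe_one, map_one, mul_one]
    rw [hconst, integral_const, smul_smul, measureReal_def]
    have hfin : ν Set.univ < ⊤ := by rw [huniv1]; exact isCompact_singleton.measure_lt_top
    have hpos : 0 < (ν Set.univ).toReal :=
      ENNReal.toReal_pos (isOpen_univ.measure_ne_zero ν Set.univ_nonempty) hfin.ne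
    rw [inv_mul_cancel₀ hpos.ne', one_smul]
  | k + 1, hk, ν, hν, g => by
    haveI := hν
    have hcn : n - (k + 1) < n := by omega
    have hc0 : 0 < n - (k + 1) := by omega
    -- the recursion
    have e : whittakerIter (K := K) (k + 1) φ = colTransform (n - (k + 1)) hcn hc0 (whittakerIter k φ) := by
      funext x; simp only [whittakerIter, dif_pos (And.intro hcn hc0)]
    rw [e, colTransform_eq]
    -- the measures
    set Y := adelicColRange n K (n - (k + 1)) (n - (k + 1)) with hY
    set H := adelicColRange n K ((n - (k + 1)) + 1) (n - 1) with hH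
    set μY : Measure ↥Y := Measure.haar with hμY
    set μH : Measure ↥H := Measure.haar with hμH
    have hck : (n - (k + 1)) + 1 = n - k := by omega
    -- inductive formula for `whittakerIter k φ` with the Haar measure `μH` (transported along `(n - (k + 1)) + 1 = n - k`)
    have IH : ∀ x, whittakerIter k φ x = ((μH (colRangeTateDomain n K ((n - (k + 1)) + 1) (n - 1))).toReal)⁻¹ •
        ∫ h in colRangeTateDomain n K ((n - (k + 1)) + 1) (n - 1),
          φ ((h : GL (Fin n) (AdeleRing (𝓞 K) K)) * x) * conj (unipotentCharFrom (K := K) ((n - (k + 1)) + 1) (h : GL (Fin n) (AdeleRing (𝓞 K) K)) : ℂ) ∂μH := by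
      intro x
      have h := whittakerIter_eq_boxIntegral hφ k (by omega)
      rw [← hck] at h
      exact h μH x
    set boxY := colRangeTateDomain n K (n - (k + 1)) (n - (k + 1)) with hboxY
    set boxH := colRangeTateDomain n K ((n - (k + 1)) + 1) (n - 1) with hboxH
    set box := colRangeTateDomain n K (n - (k + 1)) (n - 1) with hbox
    set VY := (μY boxY).toReal with hVY
    set VH := (μH boxH).toReal with hVH
    have hVY0 : VY ≠ 0 := (ENNReal.toReal_pos (measure_colRangeTateDomain_pos_of_isHaarMeasure μY).ne'
      (measure_colRangeTateDomain_lt_top μY).ne).ne'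
    have hVH0 : VH ≠ 0 := (ENNReal.toReal_pos (measure_colRangeTateDomain_pos_of_isHaarMeasure μH).ne'
      (measure_colRangeTateDomain_lt_top μH).ne).ne'
    -- the split `box = boxH · boxY`
    obtain ⟨c₀, hc₀0, hc₀, hvol, hsplit⟩ :=
      setIntegral_box_eq_mul_setIntegral_prod (n := n) (K := K) (a := (n - (k + 1))) (b := n - 1) (n - (k + 1)) (by omega) (by omega) μH μY ν
    -- the two-variable integrand
    set G : ↥H → ↥Y → ℂ := fun h y =>
      φ ((h : GL (Fin n) (AdeleRing (𝓞 K) K)) * (y : GL (Fin n) (AdeleRing (𝓞 K) K)) * g) *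
        (conj (unipotentCharFrom (K := K) ((n - (k + 1)) + 1) (h : GL (Fin n) (AdeleRing (𝓞 K) K)) : ℂ) *
          conj (adeleAddChar K (((y : GL (Fin n) (AdeleRing (𝓞 K) K)) : Matrix (Fin n) (Fin n) (AdeleRing (𝓞 K) K))
            ⟨(n - (k + 1)) - 1, by omega⟩ ⟨(n - (k + 1)), hcn⟩) : ℂ)) with hG
    -- LHS: insert the inductive formula and pull out the constants
    have hL : ∫ y in boxY, colIntegrand (n - (k + 1)) hcn hc0 (whittakerIter k φ) g y ∂μY =
        VH⁻¹ • ∫ y in boxY, ∫ h in boxH, G h y ∂μH ∂μY := by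
      have e1 : ∀ y : ↥Y, colIntegrand (n - (k + 1)) hcn hc0 (whittakerIter k φ) g y = VH⁻¹ • ∫ h in boxH, G h y ∂μH := by
        intro y
        unfold colIntegrand
        rw [IH, smul_mul_assoc, ← integral_mul_const]
        congr 1
        refine setIntegral_congr_fun measurableSet_colRangeTateDomain fun h _ => ?_
        simp only [hG, mul_assoc]
      simp_rw [e1]
      exact integral_smul _ _
    -- RHS: split coordinates (in the order `y` outer, `h` inner)
    have hR : ∫ u in box, φ ((u : GL (Fin n) (AdeleRing (𝓞 K) K)) * g) *
        conj (unipotentCharFrom (K := K) (n - (k + 1)) (u : GL (Fin n) (AdeleRing (𝓞 K) K)) : ℂ) ∂ν =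
        c₀.toReal • ∫ y in boxY, ∫ h in boxH, G h y ∂μH ∂μY := by
      have hF : Continuous fun u : ↥(adelicColRange n K (n - (k + 1)) (n - 1)) =>
          φ ((u : GL (Fin n) (AdeleRing (𝓞 K) K)) * g) * conj (unipotentCharFrom (K := K) (n - (k + 1)) (u : GL (Fin n) (AdeleRing (𝓞 K) K)) : ℂ) := by
        refine (hφ.comp (continuous_subtype_val.mul continuous_const)).mul
          (Complex.continuous_conj.comp (continuous_subtype_val.comp ((continuous_adeleAddChar K).comp ?_)))
        unfold superdiagSumFrom
        refine continuous_finsetSum _ fun j _ => ?_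
        split_ifs
        · exact continuous_adelicColRange_apply _ _
        · exact continuous_const
      rw [(hsplit _ hF).2]
      congr 1
      refine setIntegral_congr_fun measurableSet_colRangeTateDomain fun y _ =>
        setIntegral_congr_fun measurableSet_colRangeTateDomain fun h _ => ?_
      -- `ψ_{≥(n - (k + 1))}(h y) = ψ_{≥(n - (k + 1))+1}(h) ψ(y_{(n - (k + 1))-1,(n - (k + 1))})`
      rw [coe_colSplitHomeomorph_apply, hG]
      simp only
      rw [unipotentCharFrom_apply, superdiagSumFrom_high_mul_low hcn hc0 h.2 y.2, AddChar.map_add_eq_mul,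
        Circle.coe_mul, map_mul, ← unipotentCharFrom_apply, mul_assoc]
    rw [hL, hR, smul_smul, smul_smul]
    congr 1
    -- the constants: `VY⁻¹ VH⁻¹ = (ν box)⁻¹ c₀`
    rw [hvol, ENNReal.toReal_mul, ENNReal.toReal_mul, ← hVH, ← hVY]
    have hc' : c₀.toReal ≠ 0 := ENNReal.toReal_ne_zero.2 ⟨hc₀0, hc₀⟩
    field_simp

end Bottom

end Literature.NumberTheory.Automorphic
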